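import Mathlib
import Literature.Analysis.Fourier.HilbertTransformLineMultiplier
import Literature.Analysis.FunctionSpaces.PlancherelL1L2
import HarnessLib

/-!
# The truncated Hilbert-transform multipliers converge in `L²(|𝓕f|² dk)`

`Literature/Analysis/Fourier`. Continuation of `HilbertTransformLineMultiplier.lean`. With the multipliers
`m_n(k) = −(2/π)(Si(2πk(n+1)) − Si(2πk/(n+1)))·i` of the truncations `H_{1/(n+1),n+1}` (`|m_n| ≤ 7`,
`m_n(k) → m_∞(k) := −i·sgn k`) and the Fourier integral `𝓕f` of a real `f ∈ L¹ ∩ L²` (square integrable by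
Plancherel, `Literature.Analysis.FunctionSpaces.lintegral_enorm_sq_fourierIntegral_eq`), dominated convergence gives

* `tendsto_lintegral_multiplier_sub_lim` — `A_n := ∫ ‖(m_n − m_∞)·𝓕f‖ₑ² dk → 0`;
* `lintegral_multiplier_sub_sq_le` — `∫ ‖(m_n − m_m)·𝓕f‖ₑ² ≤ 2A_n + 2A_m` (so `(m_n 𝓕f)` is Cauchy in `L²`);
* `tendsto_lintegral_multiplier_sq` — `∫ ‖m_n·𝓕f‖ₑ² → ∫ ‖f‖ₑ²` (`|m_∞| = 1` off the null set `{0}`, Plancherel).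

This is the dominated-convergence step of [cite: Grafakos2014, eqs. (5.1.11)–(5.1.13)] («uniformly bounded by 8 and
converge … the Lebesgue dominated convergence theorem … allows the passage of the limit inside the integral»), written on
the Fourier side of an `L¹ ∩ L²` function; it feeds the isometry `‖Hf‖₂ = ‖f‖₂` [cite: Grafakos2014, eq. (5.1.14)]
(`HilbertTransformLineL2.lean`). No definitions. WHAT THIS IS NOT (cell ns-blowup bookkeeping): not Navier–Stokes.
-/

namespace Literature.Analysis.Fourier

open _root_.MeasureTheory Set Filter _root_.Complex
open Literature.NumberTheory.ConnesConsani2021 Literature.Analysis.FunctionSpaces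
open scoped Real Topology ENNReal FourierTransform

/-! ### Plumbing -/

/-- `‖a − b‖ₑ² ≤ 2‖a − c‖ₑ² + 2‖b − c‖ₑ²` in `ℂ`. [folklore] -/
private theorem enorm_sub_sq_le (a b c : ℂ) :
    ‖a - b‖ₑ ^ 2 ≤ 2 * ‖a - c‖ₑ ^ 2 + 2 * ‖b - c‖ₑ ^ 2 := by
  have h1 : ‖a - b‖ ≤ ‖a - c‖ + ‖b - c‖ := by
    calc ‖a - b‖ = ‖(a - c) - (b - c)‖ := by congr 1; ring
      _ ≤ ‖a - c‖ + ‖b - c‖ := norm_sub_le _ _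
  have h : ‖a - b‖ ^ 2 ≤ 2 * ‖a - c‖ ^ 2 + 2 * ‖b - c‖ ^ 2 := by
    nlinarith [norm_nonneg (a - c), norm_nonneg (b - c), norm_nonneg (a - b),
      sq_nonneg (‖a - c‖ - ‖b - c‖)]
  have e : ∀ z : ℂ, ‖z‖ₑ ^ 2 = ENNReal.ofReal (‖z‖ ^ 2) := fun z => by
    rw [← ofReal_norm, ENNReal.ofReal_pow (norm_nonneg _)]
  rw [e, e, e]
  calc ENNReal.ofReal (‖a - b‖ ^ 2) ≤ ENNReal.ofReal (2 * ‖a - c‖ ^ 2 + 2 * ‖b - c‖ ^ 2) :=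
        ENNReal.ofReal_le_ofReal h
    _ = 2 * ENNReal.ofReal (‖a - c‖ ^ 2) + 2 * ENNReal.ofReal (‖b - c‖ ^ 2) := by
        rw [ENNReal.ofReal_add (by positivity) (by positivity), ENNReal.ofReal_mul (by norm_num),
          ENNReal.ofReal_mul (by norm_num), ENNReal.ofReal_ofNat]

/-- `‖z‖ ≤ C` (real `C ≥ 0`) gives `‖z‖ₑ ≤ ofReal C`. [folklore] -/
private theorem enorm_le_ofReal {z : ℂ} {C : ℝ} (h : ‖z‖ ≤ C) : ‖z‖ₑ ≤ ENNReal.ofReal C := by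
  rw [← ofReal_norm]; exact ENNReal.ofReal_le_ofReal h

/-- A real `L²` function is an `L²` function after the embedding `ℝ ↪ ℂ`. [folklore] -/
private theorem memLp_ofReal {g : ℝ → ℝ} (hg : MemLp g 2) : MemLp (fun x => (g x : ℂ)) 2 :=
  MemLp.of_le hg (Complex.continuous_ofReal.comp_aestronglyMeasurable hg.1)
    (ae_of_all _ fun x => by rw [Complex.norm_real])

/-- `Real.sign` is measurable. [folklore] -/
private theorem measurable_real_sign : Measurable Real.sign := by
  have h : Real.sign = fun r : ℝ => if r < 0 then (-1 : ℝ) else if 0 < r then 1 else 0 := by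
    funext r; rfl
  rw [h]
  exact Measurable.ite measurableSet_Iio measurable_const
    (Measurable.ite measurableSet_Ioi measurable_const measurable_const)

/-! ### The objects: `𝓕f`, the multipliers `m_n`, the limit `m_∞` -/

/-- The Fourier integral of the complexified `f ∈ L¹ ∩ L²` is square integrable with the same `L²` mass
(Plancherel on `L¹ ∩ L²`). [folklore] -/
private theorem lintegral_fourier_sq_eq {f : ℝ → ℝ} (hf : Integrable f) (hf2 : MemLp f 2) :
    (∫⁻ k, ‖𝓕 (fun x => (f x : ℂ)) k‖ₑ ^ 2) = ∫⁻ x, ‖f x‖ₑ ^ 2 := by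
  rw [lintegral_enorm_sq_fourierIntegral_eq hf.ofReal (memLp_ofReal hf2)]
  refine lintegral_congr fun x => ?_
  rw [← ofReal_norm, Complex.norm_real, ofReal_norm]

/-- `∫ ‖f‖ₑ² < ∞` for `f ∈ L²`. [folklore] -/
private theorem lintegral_sq_lt_top {f : ℝ → ℝ} (hf2 : MemLp f 2) : (∫⁻ x, ‖f x‖ₑ ^ 2) < ∞ := by
  have h := lintegral_rpow_enorm_lt_top_of_eLpNorm_lt_top two_ne_zero ENNReal.ofNat_ne_top
    hf2.eLpNorm_lt_top
  simpa [ENNReal.rpow_two] using h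

/-- The multiplier sequence is continuous in `k`. [folklore] -/
private theorem continuous_truncMultiplier (n : ℕ) :
    Continuous fun k : ℝ => (((-(2 / π * (sinIntegral (2 * π * k * ((n : ℝ) + 1)) -
      sinIntegral (2 * π * k * (1 / ((n : ℝ) + 1)))))) : ℝ) : ℂ) * I := by
  have h1 : Continuous fun k : ℝ => sinIntegral (2 * π * k * ((n : ℝ) + 1)) :=
    continuous_sinIntegral.comp (by fun_prop)
  have h2 : Continuous fun k : ℝ => sinIntegral (2 * π * k * (1 / ((n : ℝ) + 1))) :=
    continuous_sinIntegral.comp (by fun_prop)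
  exact (Complex.continuous_ofReal.comp (((h1.sub h2).const_mul (2 / π)).neg)).mul continuous_const

/-- The limit multiplier `−i·sgn k` is measurable and unimodular off `k = 0`. [folklore] -/
private theorem measurable_limMultiplier : Measurable fun k : ℝ => (((-Real.sign k) : ℝ) : ℂ) * I :=
  (Complex.measurable_ofReal.comp measurable_real_sign.neg).mul_const I

/-- `‖−sgn k · i‖ = 1` for `k ≠ 0`. [folklore] -/
private theorem norm_limMultiplier {k : ℝ} (hk : k ≠ 0) : ‖(((-Real.sign k) : ℝ) : ℂ) * I‖ = 1 := by
  rw [norm_mul, Complex.norm_I, mul_one, Complex.norm_real, Real.norm_eq_abs, abs_neg]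
  rcases lt_or_gt_of_ne hk with h | h
  · rw [Real.sign_of_neg h]; norm_num
  · rw [Real.sign_of_pos h]; norm_num

/-- `‖−sgn k · i‖ ≤ 1` for all `k`. [folklore] -/
private theorem norm_limMultiplier_le (k : ℝ) : ‖(((-Real.sign k) : ℝ) : ℂ) * I‖ ≤ 1 := by
  rcases eq_or_ne k 0 with rfl | hk
  · simp
  · exact (norm_limMultiplier hk).le

/-! ### Dominated convergence -/

/-- **The multipliers converge in the weighted sense**: `A_n := ∫ ‖(m_n − m_∞)·𝓕f‖ₑ² → 0` (dominated convergence,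
bound `64‖𝓕f‖ₑ²`). [cite: Grafakos2014, eqs. (5.1.11)–(5.1.13)] -/
theorem tendsto_lintegral_multiplier_sub_lim {f : ℝ → ℝ} (hf : Integrable f) (hf2 : MemLp f 2) :
    Tendsto (fun n : ℕ => ∫⁻ k, ‖((((-(2 / π * (sinIntegral (2 * π * k * ((n : ℝ) + 1)) -
          sinIntegral (2 * π * k * (1 / ((n : ℝ) + 1)))))) : ℝ) : ℂ) * I -
        (((-Real.sign k) : ℝ) : ℂ) * I) * 𝓕 (fun x => (f x : ℂ)) k‖ₑ ^ 2) atTop (𝓝 0) := by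
  have hFc : Continuous (𝓕 (fun x => (f x : ℂ))) := continuous_fourierIntegral hf.ofReal
  have hmeas : ∀ n : ℕ, AEMeasurable (fun k => ‖((((-(2 / π * (sinIntegral (2 * π * k * ((n : ℝ) + 1)) -
          sinIntegral (2 * π * k * (1 / ((n : ℝ) + 1)))))) : ℝ) : ℂ) * I -
        (((-Real.sign k) : ℝ) : ℂ) * I) * 𝓕 (fun x => (f x : ℂ)) k‖ₑ ^ 2) volume := fun n =>
    ((((continuous_truncMultiplier n).measurable.sub measurable_limMultiplier).mul
      hFc.measurable).enorm.pow_const 2).aemeasurable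
  have hbound : ∀ n : ℕ, ∀ k : ℝ, ‖((((-(2 / π * (sinIntegral (2 * π * k * ((n : ℝ) + 1)) -
          sinIntegral (2 * π * k * (1 / ((n : ℝ) + 1)))))) : ℝ) : ℂ) * I -
        (((-Real.sign k) : ℝ) : ℂ) * I) * 𝓕 (fun x => (f x : ℂ)) k‖ₑ ^ 2 ≤
      64 * ‖𝓕 (fun x => (f x : ℂ)) k‖ₑ ^ 2 := by
    intro n k
    rw [enorm_mul, mul_pow]
    have h8 : ‖(((-(2 / π * (sinIntegral (2 * π * k * ((n : ℝ) + 1)) -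
          sinIntegral (2 * π * k * (1 / ((n : ℝ) + 1)))))) : ℝ) : ℂ) * I -
        (((-Real.sign k) : ℝ) : ℂ) * I‖ₑ ≤ 8 := by
      have hle : ‖(((-(2 / π * (sinIntegral (2 * π * k * ((n : ℝ) + 1)) -
          sinIntegral (2 * π * k * (1 / ((n : ℝ) + 1)))))) : ℝ) : ℂ) * I -
          (((-Real.sign k) : ℝ) : ℂ) * I‖ ≤ 8 := by
        have h := norm_sub_le ((((-(2 / π * (sinIntegral (2 * π * k * ((n : ℝ) + 1)) -
          sinIntegral (2 * π * k * (1 / ((n : ℝ) + 1)))))) : ℝ) : ℂ) * I) ((((-Real.sign k) : ℝ) : ℂ) * I)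
        have h7 := norm_hilbertTruncMultiplier_le (2 * π * k * (1 / ((n : ℝ) + 1))) (2 * π * k * ((n : ℝ) + 1))
        have h1 := norm_limMultiplier_le k
        linarith
      have h' := enorm_le_ofReal hle
      rwa [show ENNReal.ofReal 8 = 8 by simp] at h'
    calc _ ≤ (8 : ℝ≥0∞) ^ 2 * ‖𝓕 (fun x => (f x : ℂ)) k‖ₑ ^ 2 := by gcongr
      _ = 64 * ‖𝓕 (fun x => (f x : ℂ)) k‖ₑ ^ 2 := by norm_num
  have hfin : (∫⁻ k, 64 * ‖𝓕 (fun x => (f x : ℂ)) k‖ₑ ^ 2) ≠ ∞ := by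
    rw [lintegral_const_mul' _ _ (by norm_num), lintegral_fourier_sq_eq hf hf2]
    exact ENNReal.mul_ne_top (by norm_num) (lintegral_sq_lt_top hf2).ne
  have hlim : ∀ k : ℝ, Tendsto (fun n : ℕ => ‖((((-(2 / π * (sinIntegral (2 * π * k * ((n : ℝ) + 1)) -
          sinIntegral (2 * π * k * (1 / ((n : ℝ) + 1)))))) : ℝ) : ℂ) * I -
        (((-Real.sign k) : ℝ) : ℂ) * I) * 𝓕 (fun x => (f x : ℂ)) k‖ₑ ^ 2) atTop (𝓝 0) := by
    intro k
    have h1 : Tendsto (fun n : ℕ => (((-(2 / π * (sinIntegral (2 * π * k * ((n : ℝ) + 1)) -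
          sinIntegral (2 * π * k * (1 / ((n : ℝ) + 1)))))) : ℝ) : ℂ) * I) atTop
        (𝓝 ((((-Real.sign k) : ℝ) : ℂ) * I)) :=
      ((Complex.continuous_ofReal.tendsto _).comp (tendsto_hilbertTruncMultiplier k)).mul_const I
    have h2 := ENNReal.Tendsto.pow (n := 2)
      ((h1.sub_const ((((-Real.sign k) : ℝ) : ℂ) * I)).mul_const (𝓕 (fun x => (f x : ℂ)) k)).enorm
    simpa using h2
  have h := tendsto_lintegral_of_dominated_convergence' (μ := volume) _ hmeas
    (fun n => ae_of_all _ (hbound n)) hfin (ae_of_all _ hlim)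
  simpa using h

/-- **Cauchy bound on the Fourier side**: `∫ ‖(m_n − m_m)·𝓕f‖ₑ² ≤ 2A_n + 2A_m` with
`A_j = ∫ ‖(m_j − m_∞)·𝓕f‖ₑ²`. [cite: Grafakos2014, eqs. (5.1.11)–(5.1.13)] -/
theorem lintegral_multiplier_sub_sq_le {f : ℝ → ℝ} (hf : Integrable f) (n m : ℕ) :
    (∫⁻ k, ‖((((-(2 / π * (sinIntegral (2 * π * k * ((n : ℝ) + 1)) -
          sinIntegral (2 * π * k * (1 / ((n : ℝ) + 1)))))) : ℝ) : ℂ) * I -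
        (((-(2 / π * (sinIntegral (2 * π * k * ((m : ℝ) + 1)) -
          sinIntegral (2 * π * k * (1 / ((m : ℝ) + 1)))))) : ℝ) : ℂ) * I) *
        𝓕 (fun x => (f x : ℂ)) k‖ₑ ^ 2) ≤
      2 * (∫⁻ k, ‖((((-(2 / π * (sinIntegral (2 * π * k * ((n : ℝ) + 1)) -
          sinIntegral (2 * π * k * (1 / ((n : ℝ) + 1)))))) : ℝ) : ℂ) * I -
        (((-Real.sign k) : ℝ) : ℂ) * I) * 𝓕 (fun x => (f x : ℂ)) k‖ₑ ^ 2) +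
      2 * (∫⁻ k, ‖((((-(2 / π * (sinIntegral (2 * π * k * ((m : ℝ) + 1)) -
          sinIntegral (2 * π * k * (1 / ((m : ℝ) + 1)))))) : ℝ) : ℂ) * I -
        (((-Real.sign k) : ℝ) : ℂ) * I) * 𝓕 (fun x => (f x : ℂ)) k‖ₑ ^ 2) := by
  have hFc : Continuous (𝓕 (fun x => (f x : ℂ))) := continuous_fourierIntegral hf.ofReal
  have hmn : ∀ j : ℕ, Measurable (fun k => ‖((((-(2 / π * (sinIntegral (2 * π * k * ((j : ℝ) + 1)) -
      sinIntegral (2 * π * k * (1 / ((j : ℝ) + 1)))))) : ℝ) : ℂ) * I -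
      (((-Real.sign k) : ℝ) : ℂ) * I) * 𝓕 (fun x => (f x : ℂ)) k‖ₑ ^ 2) := fun j =>
    ((((continuous_truncMultiplier j).measurable.sub measurable_limMultiplier).mul
      hFc.measurable).enorm.pow_const 2)
  rw [← lintegral_const_mul _ (hmn n), ← lintegral_const_mul _ (hmn m),
    ← lintegral_add_left ((hmn n).const_mul 2)]
  refine lintegral_mono fun k => ?_
  rw [sub_mul, sub_mul, sub_mul]
  exact enorm_sub_sq_le _ _ _

/-- **Norm convergence of the multipliers**: `∫ ‖m_n·𝓕f‖ₑ² → ∫ ‖f‖ₑ²` (dominated convergence with bound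
`49‖𝓕f‖ₑ²`, `|m_∞| = 1` off the null set `{0}`, Plancherel). [cite: Grafakos2014, eqs. (5.1.11)–(5.1.14)] -/
theorem tendsto_lintegral_multiplier_sq {f : ℝ → ℝ} (hf : Integrable f) (hf2 : MemLp f 2) :
    Tendsto (fun n : ℕ => ∫⁻ k, ‖(((-(2 / π * (sinIntegral (2 * π * k * ((n : ℝ) + 1)) -
          sinIntegral (2 * π * k * (1 / ((n : ℝ) + 1)))))) : ℝ) : ℂ) * I *
        𝓕 (fun x => (f x : ℂ)) k‖ₑ ^ 2) atTop (𝓝 (∫⁻ x, ‖f x‖ₑ ^ 2)) := by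
  have hFc : Continuous (𝓕 (fun x => (f x : ℂ))) := continuous_fourierIntegral hf.ofReal
  have hmeas : ∀ n : ℕ, AEMeasurable (fun k => ‖(((-(2 / π * (sinIntegral (2 * π * k * ((n : ℝ) + 1)) -
          sinIntegral (2 * π * k * (1 / ((n : ℝ) + 1)))))) : ℝ) : ℂ) * I *
        𝓕 (fun x => (f x : ℂ)) k‖ₑ ^ 2) volume := fun n =>
    ((((continuous_truncMultiplier n).measurable).mul hFc.measurable).enorm.pow_const 2).aemeasurable
  have hbound : ∀ n : ℕ, ∀ k : ℝ, ‖(((-(2 / π * (sinIntegral (2 * π * k * ((n : ℝ) + 1)) -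
          sinIntegral (2 * π * k * (1 / ((n : ℝ) + 1)))))) : ℝ) : ℂ) * I *
        𝓕 (fun x => (f x : ℂ)) k‖ₑ ^ 2 ≤ 49 * ‖𝓕 (fun x => (f x : ℂ)) k‖ₑ ^ 2 := by
    intro n k
    rw [enorm_mul, mul_pow]
    have h7 : ‖(((-(2 / π * (sinIntegral (2 * π * k * ((n : ℝ) + 1)) -
          sinIntegral (2 * π * k * (1 / ((n : ℝ) + 1)))))) : ℝ) : ℂ) * I‖ₑ ≤ 7 := by
      have h' := enorm_le_ofReal (norm_hilbertTruncMultiplier_le (2 * π * k * (1 / ((n : ℝ) + 1)))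
        (2 * π * k * ((n : ℝ) + 1)))
      rwa [show ENNReal.ofReal 7 = 7 by simp] at h'
    calc _ ≤ (7 : ℝ≥0∞) ^ 2 * ‖𝓕 (fun x => (f x : ℂ)) k‖ₑ ^ 2 := by gcongr
      _ = 49 * ‖𝓕 (fun x => (f x : ℂ)) k‖ₑ ^ 2 := by norm_num
  have hfin : (∫⁻ k, 49 * ‖𝓕 (fun x => (f x : ℂ)) k‖ₑ ^ 2) ≠ ∞ := by
    rw [lintegral_const_mul' _ _ (by norm_num), lintegral_fourier_sq_eq hf hf2]
    exact ENNReal.mul_ne_top (by norm_num) (lintegral_sq_lt_top hf2).ne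
  -- pointwise limit `‖m_∞ 𝓕f‖ₑ² = ‖𝓕f‖ₑ²` off `k = 0`
  have hlim : ∀ᵐ k : ℝ, Tendsto (fun n : ℕ => ‖(((-(2 / π * (sinIntegral (2 * π * k * ((n : ℝ) + 1)) -
          sinIntegral (2 * π * k * (1 / ((n : ℝ) + 1)))))) : ℝ) : ℂ) * I *
        𝓕 (fun x => (f x : ℂ)) k‖ₑ ^ 2) atTop (𝓝 (‖𝓕 (fun x => (f x : ℂ)) k‖ₑ ^ 2)) := by
    filter_upwards [compl_mem_ae_iff.mpr (measure_singleton (0 : ℝ))] with k hk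
    have hk0 : k ≠ 0 := fun h => hk (by simp [h])
    have h1 : Tendsto (fun n : ℕ => (((-(2 / π * (sinIntegral (2 * π * k * ((n : ℝ) + 1)) -
          sinIntegral (2 * π * k * (1 / ((n : ℝ) + 1)))))) : ℝ) : ℂ) * I) atTop
        (𝓝 ((((-Real.sign k) : ℝ) : ℂ) * I)) :=
      ((Complex.continuous_ofReal.tendsto _).comp (tendsto_hilbertTruncMultiplier k)).mul_const I
    have h2 := ENNReal.Tendsto.pow (n := 2) (h1.mul_const (𝓕 (fun x => (f x : ℂ)) k)).enorm
    have h3 : ‖(((-Real.sign k) : ℝ) : ℂ) * I * 𝓕 (fun x => (f x : ℂ)) k‖ₑ ^ 2 =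
        ‖𝓕 (fun x => (f x : ℂ)) k‖ₑ ^ 2 := by
      rw [enorm_mul, ← ofReal_norm ((((-Real.sign k) : ℝ) : ℂ) * I), norm_limMultiplier hk0]
      simp
    rw [h3] at h2
    exact h2
  have h := tendsto_lintegral_of_dominated_convergence' (μ := volume) _ hmeas
    (fun n => ae_of_all _ (hbound n)) hfin hlim
  rwa [lintegral_fourier_sq_eq hf hf2] at h

end Literature.Analysis.Fourier
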